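import Summits.QuantumFields.QCD.Theorems.SpectralDefectExtinctionChiralDescentSharedChiralItems
import Summits.QuantumFields.QCD.Theses.EulerDescent

/-!
# Crux idea `gap-upset-recut` for `ChiralDescent` (stmt-QuantumFields-17527) — planner sketch
# (crux-ideate round 2, ideator 5, 2026-08-17).  NO skeleton: first lemmas + certified comparisons only.

The dead line `Sketch` reduced the crux to E ⇔ (H1 ∧ H2) for the hypothesis' regularisation `reg`, with the BODY
up-set `S(reg) = {μ | body above μ}`; H1 (OPENNESS ⇔ item 18327 `MassContinuation`) is "body + one rate above the
minimum of `S` ⇒ body below it" — a continuation into territory about which NOTHING is known, and it killed the line.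

This sketch cuts E with a SECOND up-set, the UNIFORM-GAP up-set `G(reg) = {μ | one lattice rate ε on every tuple above μ}`
(body-free: it reads only `β_k, L_k, a_k, m_f(k)`), and proves, sorry-free:

* §1 `exists_above_not_gap_of_gapUpset` — E from three pieces:
  (Q1) body at EVERY tuple ⇒ some offset without uniform rate (old H2, ⇐ item 18328, landed);
  (Q2) `G` NEVER STARTS AT A BODY OFFSET: body above μ ∧ μ ∈ G ⇒ some μ' < μ is in G (conclusion LATTICE-ONLY);
  (Q3) BODY FOLLOWS THE GAP: μ < ν, μ ∈ G, body above ν ⇒ body above ν − δ (continuation INTO certified-gapped territory).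
  Proof: bounded branch `μ* = min S`; if `μ* ∈ G`, Q2 gives `μ' < μ*` in `G`, Q3 gives body above `μ* − δ` — against
  minimality; unbounded branch Q1.
* §1 `openness_of_gapUpset` (Q2 ∧ Q3 ⇒ H1) and `bodyIntoGap_of_openness` (H1 ⇒ Q3, `G` an up-set): Q3 is WEAKER than the
  dead stub's H1 ≡ 18327; the extra strength sits in the body-free Q2.
* §2 the QCD instances spelled out in tree vocabulary, `chiralPointOfThreshold_of_gapUpset` (E for `reg`) and
  `ChiralDescent_of_gapUpset` — the crux BY NAME from (Q1 ⇐ 18328, Q2, Q3) via the landed closer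
  `chiralDescent_of_chiralPointOfThreshold` (p137636).
* §3 `bodyIntoGap_of_retypedContinuumComplement` — on INTERIOR regularisations Q3 (even in its global form) is an INSTANCE
  of the existing crux `EulerDescent.RetypedContinuumComplement` (stmt-QuantumFields-16903) applied to the `m_crit`-shift of
  `reg` by μ: the hard half lands on a STAFFED item of another route whose IR input ("a lattice gap at every positive tuple")
  the up-set `G` supplies with one uniform rate.

Pure logic over `QCDOS.lean` + landed glue; no new physics is proved here.
-/

namespace Summit.QuantumFields.QCD.Cruxes.ChiralDescent.GapUpset

open Filter
open Literature.MathematicalPhysics.QuantumFieldTheory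
open Summit.QuantumFields.QCD.Cruxes.ChiralDescent.InfimumDescent

variable {Nf : ℕ}

/-! ## §1 Two up-sets (abstract order theory on `Fin N_f → ℝ`) -/

/-- **E from (Q1, Q2, Q3).**  `P` a per-tuple property (`0 < N_f`), `G` a property of offsets.  If (Q1) `P` everywhere
forces `¬ G` somewhere, (Q2) `P` above `μ` and `G μ` force `G μ'` for some `μ' < μ`, and (Q3) `G μ`, `μ < ν` and `P`
above `ν` force `P` above `ν − δ` for some `δ > 0`, then a non-empty up-set `{μ | P above μ}` contains an offset at which
`G` fails: its attained infimum (bounded branch) or the Q1 offset (unbounded branch). [folklore] -/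
theorem exists_above_not_gap_of_gapUpset (hNf : 0 < Nf) (P : (Fin Nf → ℝ) → Prop) (G : ℝ → Prop)
    (hQ1 : (∀ m, P m) → ∃ μ : ℝ, ¬ G μ)
    (hQ2 : ∀ μ : ℝ, (∀ m : Fin Nf → ℝ, (∀ f, μ < m f) → P m) → G μ → ∃ μ' : ℝ, μ' < μ ∧ G μ')
    (hQ3 : ∀ μ ν : ℝ, μ < ν → G μ → (∀ m : Fin Nf → ℝ, (∀ f, ν < m f) → P m) →
      ∃ δ > (0 : ℝ), ∀ m : Fin Nf → ℝ, (∀ f, ν - δ < m f) → P m)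
    {M₁ : ℝ} (hM : ∀ m : Fin Nf → ℝ, (∀ f, M₁ < m f) → P m) :
    ∃ μ : ℝ, (∀ m : Fin Nf → ℝ, (∀ f, μ < m f) → P m) ∧ ¬ G μ := by
  classical
  set S : Set ℝ := {μ : ℝ | ∀ m : Fin Nf → ℝ, (∀ f, μ < m f) → P m} with hS
  have hne : S.Nonempty := ⟨M₁, hM⟩
  by_cases hbdd : BddBelow S
  · have hinf : sInf S ∈ S := forall_above_csInf hNf P hne hbdd
    refine ⟨sInf S, hinf, fun hG => ?_⟩
    obtain ⟨μ', hμ'lt, hGμ'⟩ := hQ2 _ hinf hG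
    obtain ⟨δ, hδ, hB'⟩ := hQ3 μ' (sInf S) hμ'lt hGμ' hinf
    have hle : sInf S ≤ sInf S - δ := csInf_le hbdd hB'
    linarith
  · have hall : ∀ μ, μ ∈ S := by
      intro μ
      rw [bddBelow_def] at hbdd
      push Not at hbdd
      obtain ⟨y, hyS, hy⟩ := hbdd μ
      exact fun m hm => hyS m fun f => lt_of_le_of_lt hy.le (hm f)
    obtain ⟨μ, hμ⟩ := hQ1 fun m => hall _ m (neg_sum_abs_sub_one_lt m)
    exact ⟨μ, hall μ, hμ⟩

/-- **(Q2 ∧ Q3) ⇒ OPENNESS (H1 ≡ item 18327, per regularisation).** [folklore] -/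
theorem openness_of_gapUpset (P : (Fin Nf → ℝ) → Prop) (G : ℝ → Prop)
    (hQ2 : ∀ μ : ℝ, (∀ m : Fin Nf → ℝ, (∀ f, μ < m f) → P m) → G μ → ∃ μ' : ℝ, μ' < μ ∧ G μ')
    (hQ3 : ∀ μ ν : ℝ, μ < ν → G μ → (∀ m : Fin Nf → ℝ, (∀ f, ν < m f) → P m) →
      ∃ δ > (0 : ℝ), ∀ m : Fin Nf → ℝ, (∀ f, ν - δ < m f) → P m) :
    ∀ μ : ℝ, (∀ m : Fin Nf → ℝ, (∀ f, μ < m f) → P m) → G μ →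
      ∃ δ > (0 : ℝ), ∀ m : Fin Nf → ℝ, (∀ f, μ - δ < m f) → P m := by
  intro μ hP hG
  obtain ⟨μ', hlt, hG'⟩ := hQ2 μ hP hG
  exact hQ3 μ' μ hlt hG' hP

/-- **OPENNESS (H1) ⇒ Q3** as soon as `G` is an up-set: the hard new piece is WEAKER than the dead stub. [folklore] -/
theorem bodyIntoGap_of_openness (P : (Fin Nf → ℝ) → Prop) (G : ℝ → Prop)
    (hGmono : ∀ μ μ' : ℝ, μ ≤ μ' → G μ → G μ')
    (hopen : ∀ μ : ℝ, (∀ m : Fin Nf → ℝ, (∀ f, μ < m f) → P m) → G μ →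
      ∃ δ > (0 : ℝ), ∀ m : Fin Nf → ℝ, (∀ f, μ - δ < m f) → P m) :
    ∀ μ ν : ℝ, μ < ν → G μ → (∀ m : Fin Nf → ℝ, (∀ f, ν < m f) → P m) →
      ∃ δ > (0 : ℝ), ∀ m : Fin Nf → ℝ, (∀ f, ν - δ < m f) → P m := by
  intro μ ν hlt hG hP
  exact hopen ν hP (hGmono μ ν hlt.le hG)

/-- A GLOBAL Q3 ("`G μ`, `μ < ν`, `P` above `ν` ⇒ `P` above `μ`") gives the local one with `δ = ν − μ`. [folklore] -/
theorem bodyIntoGap_local_of_global (P : (Fin Nf → ℝ) → Prop) (G : ℝ → Prop)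
    (hQ3g : ∀ μ ν : ℝ, μ < ν → G μ → (∀ m : Fin Nf → ℝ, (∀ f, ν < m f) → P m) →
      ∀ m : Fin Nf → ℝ, (∀ f, μ < m f) → P m) :
    ∀ μ ν : ℝ, μ < ν → G μ → (∀ m : Fin Nf → ℝ, (∀ f, ν < m f) → P m) →
      ∃ δ > (0 : ℝ), ∀ m : Fin Nf → ℝ, (∀ f, ν - δ < m f) → P m := by
  intro μ ν hlt hG hP
  refine ⟨ν - μ, sub_pos.mpr hlt, fun m hm => hQ3g μ ν hlt hG hP m fun f => ?_⟩
  have := hm f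
  linarith

/-! ## §2 The QCD instances (tree vocabulary) -/

/-- The uniform-gap up-set is monotone in the offset. [folklore] -/
theorem uniformGapAbove_mono (reg : QCDRegularisation Nf) {μ μ' : ℝ} (hle : μ ≤ μ')
    (h : ∃ ε > (0 : ℝ), ∀ m : Fin Nf → ℝ, (∀ f, μ < m f) → (reg.scheme m 0 0).HasLatticeMassGap ε) :
    ∃ ε > (0 : ℝ), ∀ m : Fin Nf → ℝ, (∀ f, μ' < m f) → (reg.scheme m 0 0).HasLatticeMassGap ε := by
  obtain ⟨ε, hε, hg⟩ := h
  exact ⟨ε, hε, fun m hm => hg m fun f => lt_of_le_of_lt hle (hm f)⟩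

variable (Nf) in
/-- **Q2 — THE UNIFORM-GAP UP-SET NEVER STARTS AT A BODY OFFSET** (body-free conclusion; N_f ∈ {2,3}): for every
mass-scaling `reg` and every offset `μ` above which the body holds, ONE lattice rate on every tuple above `μ` forces one
lattice rate on every tuple above some `μ' < μ`.  Physics: a body offset `μ` lies at or above the chiral point `μ_χ`; at
`μ = μ_χ` the hypothesis fails (Goldstone: rates `→ 0`, or the 't Hooft anomaly engine by contradiction), at `μ > μ_χ` the
lattice gap of the massive phase extends below `μ` (no first-order wall at a PCAC-massive corner: uniform clustering is
an open condition in the renormalised masses — the finite-size-criterion class).  Sketch name `GapUpsetNoStart`. -/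
def GapUpsetNoStart : Prop :=
  ∀ reg : QCDRegularisation Nf, reg.HasMassScaling → ∀ μ : ℝ,
    (∀ m : Fin Nf → ℝ, (∀ f, μ < m f) →
      ∃ (z shift : QCDField Nf → ℕ → ℝ) (T : OSData (QCDField Nf) 4),
        IsQCDAlong (reg.scheme m z shift) T ∧ T.IsNontrivial QCDField.glue ∧ T.IsNonGaussian QCDField.glue ∧
          (∀ f g : Fin Nf, f ≠ g → T.IsNontrivial (QCDField.pseudoRe f g)) ∧
            ∃ Δ > 0, T.HasMassGap Δ ∧ (reg.scheme m z shift).HasLatticeMassGap Δ) →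
    (∃ ε > (0 : ℝ), ∀ m : Fin Nf → ℝ, (∀ f, μ < m f) → (reg.scheme m 0 0).HasLatticeMassGap ε) →
    ∃ μ' : ℝ, μ' < μ ∧ ∃ ε > (0 : ℝ), ∀ m : Fin Nf → ℝ, (∀ f, μ' < m f) → (reg.scheme m 0 0).HasLatticeMassGap ε

variable (Nf) in
/-- **Q3 — THE BODY FOLLOWS THE GAP** (local form; N_f ∈ {2,3}): for every mass-scaling `reg`, if ONE lattice rate holds
on every tuple above `μ`, `μ < ν`, and the body holds above `ν`, then the body holds above `ν − δ` for some `δ > 0` —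
light-quark continuation INTO CERTIFIED-GAPPED territory (fermionic UV stability + mass-equicontinuity with the IR
modulus supplied; orthant-local instance of `EulerDescent.RetypedContinuumComplement`, §3).  Sketch name `BodyIntoGap`. -/
def BodyIntoGap : Prop :=
  ∀ reg : QCDRegularisation Nf, reg.HasMassScaling → ∀ μ ν : ℝ, μ < ν →
    (∃ ε > (0 : ℝ), ∀ m : Fin Nf → ℝ, (∀ f, μ < m f) → (reg.scheme m 0 0).HasLatticeMassGap ε) →
    (∀ m : Fin Nf → ℝ, (∀ f, ν < m f) →
      ∃ (z shift : QCDField Nf → ℕ → ℝ) (T : OSData (QCDField Nf) 4),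
        IsQCDAlong (reg.scheme m z shift) T ∧ T.IsNontrivial QCDField.glue ∧ T.IsNonGaussian QCDField.glue ∧
          (∀ f g : Fin Nf, f ≠ g → T.IsNontrivial (QCDField.pseudoRe f g)) ∧
            ∃ Δ > 0, T.HasMassGap Δ ∧ (reg.scheme m z shift).HasLatticeMassGap Δ) →
    ∃ δ > (0 : ℝ), ∀ m : Fin Nf → ℝ, (∀ f, ν - δ < m f) →
      ∃ (z shift : QCDField Nf → ℕ → ℝ) (T : OSData (QCDField Nf) 4),
        IsQCDAlong (reg.scheme m z shift) T ∧ T.IsNontrivial QCDField.glue ∧ T.IsNonGaussian QCDField.glue ∧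
          (∀ f g : Fin Nf, f ≠ g → T.IsNontrivial (QCDField.pseudoRe f g)) ∧
            ∃ Δ > 0, T.HasMassGap Δ ∧ (reg.scheme m z shift).HasLatticeMassGap Δ

/-- **E for the hypothesis' regularisation from (H2 ⇐ 18328, Q2, Q3)** — the first checkable statement of the line:
threshold body above `M₁` + Q1 (old H2) + Q2 + Q3 for `reg` ⇒ an offset carrying the body with NO uniform rate above it. -/
theorem chiralPointOfThreshold_of_gapUpset (hNf : 0 < Nf) (reg : QCDRegularisation Nf)
    (hQ1 : (∀ m : Fin Nf → ℝ,
        ∃ (z shift : QCDField Nf → ℕ → ℝ) (T : OSData (QCDField Nf) 4),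
          IsQCDAlong (reg.scheme m z shift) T ∧ T.IsNontrivial QCDField.glue ∧ T.IsNonGaussian QCDField.glue ∧
            (∀ f g : Fin Nf, f ≠ g → T.IsNontrivial (QCDField.pseudoRe f g)) ∧
              ∃ Δ > 0, T.HasMassGap Δ ∧ (reg.scheme m z shift).HasLatticeMassGap Δ) →
        ∃ μ : ℝ, ∀ ε > (0 : ℝ), ∃ m : Fin Nf → ℝ, (∀ f, μ < m f) ∧ ¬ (reg.scheme m 0 0).HasLatticeMassGap ε)
    (hQ2 : ∀ μ : ℝ,
      (∀ m : Fin Nf → ℝ, (∀ f, μ < m f) →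
        ∃ (z shift : QCDField Nf → ℕ → ℝ) (T : OSData (QCDField Nf) 4),
          IsQCDAlong (reg.scheme m z shift) T ∧ T.IsNontrivial QCDField.glue ∧ T.IsNonGaussian QCDField.glue ∧
            (∀ f g : Fin Nf, f ≠ g → T.IsNontrivial (QCDField.pseudoRe f g)) ∧
              ∃ Δ > 0, T.HasMassGap Δ ∧ (reg.scheme m z shift).HasLatticeMassGap Δ) →
      (∃ ε > (0 : ℝ), ∀ m : Fin Nf → ℝ, (∀ f, μ < m f) → (reg.scheme m 0 0).HasLatticeMassGap ε) →
      ∃ μ' : ℝ, μ' < μ ∧ ∃ ε > (0 : ℝ), ∀ m : Fin Nf → ℝ, (∀ f, μ' < m f) → (reg.scheme m 0 0).HasLatticeMassGap ε)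
    (hQ3 : ∀ μ ν : ℝ, μ < ν →
      (∃ ε > (0 : ℝ), ∀ m : Fin Nf → ℝ, (∀ f, μ < m f) → (reg.scheme m 0 0).HasLatticeMassGap ε) →
      (∀ m : Fin Nf → ℝ, (∀ f, ν < m f) →
        ∃ (z shift : QCDField Nf → ℕ → ℝ) (T : OSData (QCDField Nf) 4),
          IsQCDAlong (reg.scheme m z shift) T ∧ T.IsNontrivial QCDField.glue ∧ T.IsNonGaussian QCDField.glue ∧
            (∀ f g : Fin Nf, f ≠ g → T.IsNontrivial (QCDField.pseudoRe f g)) ∧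
              ∃ Δ > 0, T.HasMassGap Δ ∧ (reg.scheme m z shift).HasLatticeMassGap Δ) →
      ∃ δ > (0 : ℝ), ∀ m : Fin Nf → ℝ, (∀ f, ν - δ < m f) →
        ∃ (z shift : QCDField Nf → ℕ → ℝ) (T : OSData (QCDField Nf) 4),
          IsQCDAlong (reg.scheme m z shift) T ∧ T.IsNontrivial QCDField.glue ∧ T.IsNonGaussian QCDField.glue ∧
            (∀ f g : Fin Nf, f ≠ g → T.IsNontrivial (QCDField.pseudoRe f g)) ∧
              ∃ Δ > 0, T.HasMassGap Δ ∧ (reg.scheme m z shift).HasLatticeMassGap Δ)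
    {M₁ : ℝ}
    (hbody : ∀ m : Fin Nf → ℝ, (∀ f, M₁ < m f) →
      ∃ (z shift : QCDField Nf → ℕ → ℝ) (T : OSData (QCDField Nf) 4),
        IsQCDAlong (reg.scheme m z shift) T ∧ T.IsNontrivial QCDField.glue ∧ T.IsNonGaussian QCDField.glue ∧
          (∀ f g : Fin Nf, f ≠ g → T.IsNontrivial (QCDField.pseudoRe f g)) ∧
            ∃ Δ > 0, T.HasMassGap Δ ∧ (reg.scheme m z shift).HasLatticeMassGap Δ) :
    ∃ μ : ℝ, (∀ m : Fin Nf → ℝ, (∀ f, μ < m f) →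
        ∃ (z shift : QCDField Nf → ℕ → ℝ) (T : OSData (QCDField Nf) 4),
          IsQCDAlong (reg.scheme m z shift) T ∧ T.IsNontrivial QCDField.glue ∧ T.IsNonGaussian QCDField.glue ∧
            (∀ f g : Fin Nf, f ≠ g → T.IsNontrivial (QCDField.pseudoRe f g)) ∧
              ∃ Δ > 0, T.HasMassGap Δ ∧ (reg.scheme m z shift).HasLatticeMassGap Δ) ∧
      ∀ ε > (0 : ℝ), ∃ m : Fin Nf → ℝ, (∀ f, μ < m f) ∧ ¬ (reg.scheme m 0 0).HasLatticeMassGap ε := by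
  obtain ⟨μ, hB, hG⟩ := exists_above_not_gap_of_gapUpset hNf
    (fun m => ∃ (z shift : QCDField Nf → ℕ → ℝ) (T : OSData (QCDField Nf) 4),
      IsQCDAlong (reg.scheme m z shift) T ∧ T.IsNontrivial QCDField.glue ∧ T.IsNonGaussian QCDField.glue ∧
        (∀ f g : Fin Nf, f ≠ g → T.IsNontrivial (QCDField.pseudoRe f g)) ∧
          ∃ Δ > 0, T.HasMassGap Δ ∧ (reg.scheme m z shift).HasLatticeMassGap Δ)
    (fun μ => ∃ ε > (0 : ℝ), ∀ m : Fin Nf → ℝ, (∀ f, μ < m f) → (reg.scheme m 0 0).HasLatticeMassGap ε)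
    (fun hall => by
      obtain ⟨μ, hμ⟩ := hQ1 hall
      refine ⟨μ, ?_⟩
      rintro ⟨ε, hε, hgap⟩
      obtain ⟨m, hm, hng⟩ := hμ ε hε
      exact hng (hgap m hm))
    (fun μ hP hG => hQ2 μ hP hG)
    (fun μ ν hlt hG hP => hQ3 μ ν hlt hG hP)
    hbody
  refine ⟨μ, hB, fun ε hε => ?_⟩
  by_contra hcon
  push Not at hcon
  exact hG ⟨ε, hε, fun m hm => hcon m hm⟩

/-- **The crux BY NAME from item 18328 (`ChiralTupleGapless`, the cheap anchor), Q2 (`GapUpsetNoStart`) and Q3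
(`BodyIntoGap`) at N_f = 2, 3** — via the landed closer `chiralDescent_of_chiralPointOfThreshold` (p137636) and the landed
`chiralPointOfBodyEverywhere_of_chiralTupleGapless` (p139859).  CONDITIONAL on the three hypotheses (conjecture class). -/
theorem ChiralDescent_of_gapUpset (h18328 : Theses.QuarksAsStableAction.ChiralTupleGapless)
    (hQ2 : GapUpsetNoStart 2 ∧ GapUpsetNoStart 3) (hQ3 : BodyIntoGap 2 ∧ BodyIntoGap 3) :
    Summit.QuantumFields.QCD.Theses.SpectralDefectExtinction.ChiralDescent := by
  refine chiralDescent_of_chiralPointOfThreshold fun Nf hNf reg hMS M₁ hbody => ?_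
  have hNf0 : 0 < Nf := by rcases hNf with rfl | rfl <;> norm_num
  have hQ2' : GapUpsetNoStart Nf := by
    rcases hNf with rfl | rfl
    exacts [hQ2.1, hQ2.2]
  have hQ3' : BodyIntoGap Nf := by
    rcases hNf with rfl | rfl
    exacts [hQ3.1, hQ3.2]
  exact chiralPointOfThreshold_of_gapUpset hNf0 reg
    (chiralPointOfBodyEverywhere_of_chiralTupleGapless h18328 Nf hNf reg hMS)
    (hQ2' reg hMS) (hQ3' reg hMS) hbody

/-- **Certified comparison: item 18327 `MassContinuation` (the dead stub H1) implies Q3 (`BodyIntoGap`).**  So the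
construction half of the re-cut is weaker than what killed line `Sketch`; the strengthening lives entirely in the
body-free Q2. [folklore] -/
theorem bodyIntoGap_of_massContinuation (h : Theses.QuarksAsStableAction.MassContinuation) (hNf : Nf = 2 ∨ Nf = 3) :
    BodyIntoGap Nf := by
  intro reg hMS μ ν hlt hG hP
  obtain ⟨ε, hε, hgap⟩ := uniformGapAbove_mono reg hlt.le hG
  exact h Nf hNf reg ν ε hMS hε hP hgap

/-! ## §3 Q3 on interior regularisations is an instance of `EulerDescent.RetypedContinuumComplement` (stmt-16903) -/

/-- The `m_crit`-shift of `reg` by `μ` runs at `m` the scheme of `reg` at `μ + m` (same `β, L, a`). [folklore] -/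
theorem shift_scheme_eq (reg : QCDRegularisation Nf) (μ : ℝ) (m : Fin Nf → ℝ) (z shift : QCDField Nf → ℕ → ℝ) :
    ({ reg with mcrit := fun k => reg.mcrit k + reg.a k * μ / reg.Zm k } : QCDRegularisation Nf).scheme m z shift
      = reg.scheme (fun f => μ + m f) z shift := by
  simp only [QCDRegularisation.scheme, QCDScheme.mk.injEq, true_and, and_true]
  funext f k
  ring

/-- **GLOBAL Q3 on INTERIOR regularisations from stmt-16903.**  If `EulerDescent.RetypedContinuumComplement` holds, then
for N_f ∈ {2,3}, every mass-scaling `reg`, every `μ < ν` with ONE lattice rate above `μ`, the body above `ν`, and the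
interior side-condition `−1 < m_crit(k) + a_k μ / Z_m(k)` eventually (the shifted zero stays on the physical branch —
the wall corner of `WallContent` excluded), the body holds at EVERY tuple above `μ`.  Proof: apply 16903 to the shift of
`reg` by `μ`; its asymptotic scaling is read off any body tuple, its heavy body is the body above `ν` (threshold
`ν − μ + 1`), its per-tuple gaps are the one rate on the orthant. [folklore] -/
theorem bodyAbove_of_retypedContinuumComplement (h16903 : Theses.EulerDescent.RetypedContinuumComplement)
    (hNf : Nf = 2 ∨ Nf = 3) (reg : QCDRegularisation Nf) (hMS : reg.HasMassScaling) {μ ν : ℝ} (hlt : μ < ν)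
    (hint : ∀ᶠ k in atTop, (-1 : ℝ) < reg.mcrit k + reg.a k * μ / reg.Zm k)
    (hG : ∃ ε > (0 : ℝ), ∀ m : Fin Nf → ℝ, (∀ f, μ < m f) → (reg.scheme m 0 0).HasLatticeMassGap ε)
    (hP : ∀ m : Fin Nf → ℝ, (∀ f, ν < m f) →
      ∃ (z shift : QCDField Nf → ℕ → ℝ) (T : OSData (QCDField Nf) 4),
        IsQCDAlong (reg.scheme m z shift) T ∧ T.IsNontrivial QCDField.glue ∧ T.IsNonGaussian QCDField.glue ∧
          (∀ f g : Fin Nf, f ≠ g → T.IsNontrivial (QCDField.pseudoRe f g)) ∧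
            ∃ Δ > 0, T.HasMassGap Δ ∧ (reg.scheme m z shift).HasLatticeMassGap Δ) :
    ∀ m : Fin Nf → ℝ, (∀ f, μ < m f) →
      ∃ (z shift : QCDField Nf → ℕ → ℝ) (T : OSData (QCDField Nf) 4),
        IsQCDAlong (reg.scheme m z shift) T ∧ T.IsNontrivial QCDField.glue ∧ T.IsNonGaussian QCDField.glue ∧
          (∀ f g : Fin Nf, f ≠ g → T.IsNontrivial (QCDField.pseudoRe f g)) ∧
            ∃ Δ > 0, T.HasMassGap Δ ∧ (reg.scheme m z shift).HasLatticeMassGap Δ := by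
  -- the shifted regularisation
  set reg' : QCDRegularisation Nf := { reg with mcrit := fun k => reg.mcrit k + reg.a k * μ / reg.Zm k } with hreg'
  have hs : ∀ (m : Fin Nf → ℝ) (z shift : QCDField Nf → ℕ → ℝ),
      reg'.scheme m z shift = reg.scheme (fun f => μ + m f) z shift := fun m z shift => shift_scheme_eq reg μ m z shift
  have hMS' : reg'.HasMassScaling := hMS
  -- asymptotic scaling from the body at the tuple ν + 1
  obtain ⟨z₀, s₀, T₀, hQ₀, -⟩ := hP (fun _ => ν + 1) (fun _ => by linarith)
  have hAS' : (reg'.scheme 0 0 0).HasAsymptoticScaling := by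
    obtain ⟨hAS, -⟩ := hQ₀
    exact hAS
  have hint' : ∀ᶠ k in atTop, (-1 : ℝ) < reg'.mcrit k := hint
  -- heavy body of the shift: threshold ν − μ + 1 > 0
  have hheavy : ∃ Mh : ℝ, 0 < Mh ∧ ∀ m : Fin Nf → ℝ, (∀ f, Mh ≤ m f) →
      ∃ (z shift : QCDField Nf → ℕ → ℝ) (T : OSData (QCDField Nf) 4),
        IsQCDAlong (reg'.scheme m z shift) T ∧ T.IsNontrivial QCDField.glue ∧ T.IsNonGaussian QCDField.glue ∧
          (∀ f g : Fin Nf, f ≠ g → T.IsNontrivial (QCDField.pseudoRe f g)) ∧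
            ∃ Δ > 0, T.HasMassGap Δ ∧ (reg'.scheme m z shift).HasLatticeMassGap Δ := by
    refine ⟨ν - μ + 1, by linarith, fun m hm => ?_⟩
    obtain ⟨z, s, T, hT⟩ := hP (fun f => μ + m f) (fun f => by have := hm f; linarith)
    exact ⟨z, s, T, by rw [hs]; exact hT⟩
  -- per-tuple gaps of the shift at positive tuples: the one rate above μ
  have hgaps : ∀ m : Fin Nf → ℝ, (∀ f, 0 < m f) → ∃ Δ > 0, (reg'.scheme m 0 0).HasLatticeMassGap Δ := by
    intro m hm
    obtain ⟨ε, hε, hg⟩ := hG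
    refine ⟨ε, hε, ?_⟩
    rw [hs]
    exact hg _ fun f => by have := hm f; linarith
  -- apply 16903 and shift back
  intro m hm
  have hpos : ∀ f, 0 < m f - μ := fun f => sub_pos.mpr (hm f)
  obtain ⟨z, s, T, hT⟩ := h16903 Nf hNf reg' hMS' hAS' hint' hheavy hgaps (fun f => m f - μ) hpos
  refine ⟨z, s, T, ?_⟩
  have heq : (fun f => μ + (m f - μ)) = m := funext fun f => by ring
  rw [hs, heq] at hT
  exact hT

/-- Hence, on interior regularisations, stmt-16903 gives the LOCAL Q3 used by the re-cut (with `δ = ν − μ`). [folklore] -/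
theorem bodyIntoGap_interior_of_retypedContinuumComplement (h16903 : Theses.EulerDescent.RetypedContinuumComplement)
    (hNf : Nf = 2 ∨ Nf = 3) (reg : QCDRegularisation Nf) (hMS : reg.HasMassScaling) {μ ν : ℝ} (hlt : μ < ν)
    (hint : ∀ᶠ k in atTop, (-1 : ℝ) < reg.mcrit k + reg.a k * μ / reg.Zm k)
    (hG : ∃ ε > (0 : ℝ), ∀ m : Fin Nf → ℝ, (∀ f, μ < m f) → (reg.scheme m 0 0).HasLatticeMassGap ε)
    (hP : ∀ m : Fin Nf → ℝ, (∀ f, ν < m f) →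
      ∃ (z shift : QCDField Nf → ℕ → ℝ) (T : OSData (QCDField Nf) 4),
        IsQCDAlong (reg.scheme m z shift) T ∧ T.IsNontrivial QCDField.glue ∧ T.IsNonGaussian QCDField.glue ∧
          (∀ f g : Fin Nf, f ≠ g → T.IsNontrivial (QCDField.pseudoRe f g)) ∧
            ∃ Δ > 0, T.HasMassGap Δ ∧ (reg.scheme m z shift).HasLatticeMassGap Δ) :
    ∃ δ > (0 : ℝ), ∀ m : Fin Nf → ℝ, (∀ f, ν - δ < m f) →
      ∃ (z shift : QCDField Nf → ℕ → ℝ) (T : OSData (QCDField Nf) 4),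
        IsQCDAlong (reg.scheme m z shift) T ∧ T.IsNontrivial QCDField.glue ∧ T.IsNonGaussian QCDField.glue ∧
          (∀ f g : Fin Nf, f ≠ g → T.IsNontrivial (QCDField.pseudoRe f g)) ∧
            ∃ Δ > 0, T.HasMassGap Δ ∧ (reg.scheme m z shift).HasLatticeMassGap Δ := by
  refine ⟨ν - μ, sub_pos.mpr hlt, fun m hm => ?_⟩
  refine bodyAbove_of_retypedContinuumComplement h16903 hNf reg hMS hlt hint hG hP m fun f => ?_
  have := hm f
  linarith

end Summit.QuantumFields.QCD.Cruxes.ChiralDescent.GapUpset
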